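import Summits.AnomalousDissipation.AnomalousDissipation.Theorems.UniformResolution.Negative.SteadyResolved

/-!
# Negative knowledge for the crux `MomentParity.UniformResolution` (stmt-AnomalousDissipation-14330), VIII:
# a Foias–Guillopé–Temam weighted `H²` bound from ONE stationarity identity (where the crux exactly lives)

Certified from the cdisprove work files of refuter-cdisprove-stmt-AnomalousDissipation-14330-0 (cycle 1).
Supports stmt-AnomalousDissipation-14330; no route-item statement is asserted. With `Negative/ResolutionCriterion.lean`
this pins the crux: its conclusion at viscosity `ν` follows from MomentClosure (Galerkin-INVARIANT loud laws, which
are FGT-stationary) plus UNIFORM INTEGRABILITY OF THE ENSTROPHY over the family — the latter is the whole open content.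

* `gradSq`, `lapSq`, `fgtWeight = (1+G)⁻⁴`, `fgtConst ν = 3072(64/(π⁴ν²)+1)²`; `exists_adapted_cut` (a dyadic cut
  `i₀(u)` with `64·2^{-i₀}(G+1) < π⁴ν²`, `4^{i₀} ≤ 4(64(G+1)/(π⁴ν²)+1)²`).
* `fgt_algebra`, `fgt_pointwise` — POINTWISE ABSORPTION for every level-`N` state:
  `(1+G)⁻⁴(∫⟪f,z⟫ − ∫⟪(ū·∇)ū,z⟫) ≤ ‖f‖₂²/ν + K(ν)/ν + (3ν/4)(1+G)⁻⁴∫‖z‖²` (`z = −ΔP_N u`; weighted Young, the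
  convection bound, the dyadic Agmon inequality of `Negative/Agmon.lean` at the adapted cut).
* `fgt_integral_bound` — if a probability law carried by level-`N` fields in a ball annihilates the single weighted
  row `(1+G)⁻⁴⟨F(u), z⟩`, then `∫(1+G)⁻⁴∫‖ΔP_N u‖² dμ ≤ 4(‖f‖₂² + K(ν))/ν²` — N-uniform, radius-free.
* `IsFGTStationary`, `lintegral_weightedDensity_le_of_fgt`, `weightedH2Bound_four_of_fgt` — the `ℝ≥0∞` form:
  `WeightedH2Bound 4` for every family of FGT-stationary laws.
-/

namespace Summit.AnomalousDissipation.AnomalousDissipation.Theorems.UniformResolution.Negative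

open MeasureTheory Filter Topology
open scoped ENNReal InnerProductSpace RealInnerProductSpace
open Literature.Analysis.FunctionSpaces Literature.Analysis.FluidPDE
open Summit.AnomalousDissipation.AnomalousDissipation.Theorems.QuarticGate.Negative
open Summit.AnomalousDissipation.AnomalousDissipation.Theorems

noncomputable section

/-- Local notation for the real Hilbert space `L²(T³; ℝ³)`. -/
local notation "L2T3" => Lp (EuclideanSpace ℝ (Fin 3)) 2 (volume : Measure (UnitAddTorus (Fin 3)))

/-! ## FGT. A weighted `H²` bound from ONE stationarity identity (Foias–Guillopé–Temam shape, exponent 4) -/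

section FGT

variable {N : ℕ} {u : Torus.energySpace (Fin 3)} {ν : ℝ} {f : UnitAddTorus (Fin 3) → EuclideanSpace ℝ (Fin 3)}

/-- The enstrophy `G(u) = 4π² Σ|k|²‖û k‖²` of a state (real, over the ball of level `N`). -/
def gradSq (N : ℕ) (u : Torus.energySpace (Fin 3)) : ℝ :=
  4 * Real.pi ^ 2 * ∑ k ∈ Torus.freqBall N, Torus.freqNormSq k * ‖coef u k‖ ^ 2

/-- `∫‖ΔP_N u‖² = 16π⁴ Σ|k|⁴‖û k‖²` as a function of the state. -/
def lapSq (N : ℕ) (u : Torus.energySpace (Fin 3)) : ℝ :=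
  16 * Real.pi ^ 4 * ∑ k ∈ Torus.freqBall N, Torus.freqNormSq k ^ 2 * ‖coef u k‖ ^ 2

/-- The FGT weight `(1 + G(u))⁻⁴`. -/
def fgtWeight (N : ℕ) (u : Torus.energySpace (Fin 3)) : ℝ := ((1 + gradSq N u) ^ 4)⁻¹

/-- The absolute constant `K(ν) = 3072 (64/(π⁴ν²) + 1)²` of the pointwise absorption. -/
def fgtConst (ν : ℝ) : ℝ := 3072 * (64 / (Real.pi ^ 4 * ν ^ 2) + 1) ^ 2

/-- `gradSq_nonneg` (bookkeeping). [folklore] -/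
theorem gradSq_nonneg (N : ℕ) (u : Torus.energySpace (Fin 3)) : 0 ≤ gradSq N u :=
  mul_nonneg (by positivity) (Finset.sum_nonneg fun k _ => mul_nonneg (Torus.freqNormSq_nonneg _) (sq_nonneg _))

/-- `lapSq_eq` (bookkeeping). [folklore] -/
theorem lapSq_eq (N : ℕ) (u : Torus.energySpace (Fin 3)) : lapSq N u = ∫ x, ‖lapTrunc N u x‖ ^ 2 :=
  (integral_norm_sq_lapTrunc u).symm

/-- `lapSq_nonneg` (bookkeeping). [folklore] -/
theorem lapSq_nonneg (N : ℕ) (u : Torus.energySpace (Fin 3)) : 0 ≤ lapSq N u := by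
  rw [lapSq_eq]; exact integral_nonneg fun x => by positivity

/-- `fgtWeight_pos` (bookkeeping). [folklore] -/
theorem fgtWeight_pos (N : ℕ) (u : Torus.energySpace (Fin 3)) : 0 < fgtWeight N u := by
  unfold fgtWeight; have := gradSq_nonneg N u; positivity

/-- `fgtWeight_le_one` (bookkeeping). [folklore] -/
theorem fgtWeight_le_one (N : ℕ) (u : Torus.energySpace (Fin 3)) : fgtWeight N u ≤ 1 := by
  unfold fgtWeight
  have h := gradSq_nonneg N u
  exact inv_le_one_of_one_le₀ (one_le_pow₀ (by linarith))

/-- **A dyadic cut adapted to the state**: `i₀` with `64·2^{-i₀}(G+1) < π⁴ν²` and `4^{i₀} ≤ 4(64(G+1)/(π⁴ν²)+1)²`. [folklore] -/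
theorem exists_adapted_cut (hν : 0 < ν) (G : ℝ) (hG : 0 ≤ G) :
    ∃ i₀ : ℕ, 64 * ((2 : ℝ)⁻¹) ^ i₀ * (G + 1) < Real.pi ^ 4 * ν ^ 2 ∧
      (4 : ℝ) ^ i₀ ≤ 4 * (64 * (G + 1) / (Real.pi ^ 4 * ν ^ 2) + 1) ^ 2 := by
  have hpi : 0 < Real.pi := Real.pi_pos
  set T : ℝ := 64 * (G + 1) / (Real.pi ^ 4 * ν ^ 2) with hT
  have hT0 : 0 < T := by positivity
  set M : ℕ := ⌈T⌉₊ with hM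
  have hM1 : 1 ≤ M := Nat.one_le_iff_ne_zero.2 (Nat.pos_iff_ne_zero.1 (Nat.ceil_pos.2 hT0))
  refine ⟨Nat.log 2 M + 1, ?_, ?_⟩
  · -- 2^{i₀} > M ≥ T
    have h1 : (M : ℝ) < (2 : ℝ) ^ (Nat.log 2 M + 1) := by
      exact_mod_cast Nat.lt_pow_succ_log_self (by norm_num) M
    have h2 : T ≤ M := Nat.le_ceil _
    have h3 : T < (2 : ℝ) ^ (Nat.log 2 M + 1) := h2.trans_lt h1
    rw [hT, div_lt_iff₀ (by positivity)] at h3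
    have h4 : ((2 : ℝ)⁻¹) ^ (Nat.log 2 M + 1) * (2 : ℝ) ^ (Nat.log 2 M + 1) = 1 := by
      rw [← mul_pow, inv_mul_cancel₀ (two_ne_zero), one_pow]
    have h5 : 0 < ((2 : ℝ)⁻¹) ^ (Nat.log 2 M + 1) := by positivity
    nlinarith
  · -- 2^{i₀} ≤ 2M ≤ 2(T+1)
    have h1 : (2 : ℝ) ^ (Nat.log 2 M + 1) ≤ 2 * M := by
      have := Nat.pow_log_le_self 2 (by omega : M ≠ 0)
      rw [pow_succ]
      have h : ((2 ^ Nat.log 2 M : ℕ) : ℝ) ≤ M := by exact_mod_cast this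
      push_cast at h
      linarith
    have h2 : (M : ℝ) ≤ T + 1 := (Nat.ceil_lt_add_one hT0.le).le
    have h3 : (2 : ℝ) ^ (Nat.log 2 M + 1) ≤ 2 * (T + 1) := by linarith
    have h4 : (4 : ℝ) ^ (Nat.log 2 M + 1) = ((2 : ℝ) ^ (Nat.log 2 M + 1)) ^ 2 := by
      rw [← pow_mul, mul_comm, pow_mul]; norm_num
    rw [h4]
    have h5 : 0 ≤ (2 : ℝ) ^ (Nat.log 2 M + 1) := by positivity
    nlinarith

/-- The real arithmetic of the pointwise FGT absorption, isolated. [folklore] -/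
theorem fgt_algebra {ν F P Qs G D2 w h Kc Ifz Icz Cv K : ℝ} (hν : 0 < ν) (hF0 : 0 ≤ F) (hP0 : 0 ≤ P)
    (hQ0 : 0 ≤ Qs) (hG0 : 0 ≤ G) (hGdef : G = 4 * Real.pi ^ 2 * P) (hD2Q : D2 = 16 * Real.pi ^ 4 * Qs)
    (hw0 : 0 < w) (hwdef : w = ((1 + G) ^ 4)⁻¹) (hh0 : 0 ≤ h)
    (hcut : 64 * h * (G + 1) < Real.pi ^ 4 * ν ^ 2)
    (hK : Kc ≤ 4 * (64 * (G + 1) / (Real.pi ^ 4 * ν ^ 2) + 1) ^ 2)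
    (hKdef : K = 3072 * (64 / (Real.pi ^ 4 * ν ^ 2) + 1) ^ 2)
    (hY1 : Ifz ≤ 2⁻¹ * (2 / ν * F + ν / 2 * D2)) (hY2 : -Icz ≤ 2⁻¹ * (2 / ν * Cv + ν / 2 * D2))
    (hKc0 : 0 ≤ Kc) (h2 : Cv ≤ (768 * Kc * P + 256 * h * Qs) * G) :
    w * (Ifz - Icz) ≤ F / ν + K / ν + 3 * ν / 4 * (w * D2) := by
  have hpi : 0 < Real.pi := Real.pi_pos
  have hD20 : 0 ≤ D2 := by rw [hD2Q]; positivity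
  -- (1) Young
  have h1 : Ifz - Icz ≤ F / ν + Cv / ν + ν / 2 * D2 := by
    have e1 : 2⁻¹ * (2 / ν * F + ν / 2 * D2) = F / ν + ν / 4 * D2 := by ring
    have e2 : 2⁻¹ * (2 / ν * Cv + ν / 2 * D2) = Cv / ν + ν / 4 * D2 := by ring
    linarith
  -- (3) the Qs-term is absorbed
  have h3 : 256 * h * Qs * G ≤ ν ^ 2 / 4 * D2 := by
    have hhG : 64 * h * G ≤ Real.pi ^ 4 * ν ^ 2 := by
      have : 64 * h * G ≤ 64 * h * (G + 1) := by nlinarith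
      linarith
    have e1 : 256 * h * Qs * G = (64 * h * G) * (4 * Qs) := by ring
    have e2 : ν ^ 2 / 4 * D2 = (Real.pi ^ 4 * ν ^ 2) * (4 * Qs) := by rw [hD2Q]; ring
    rw [e1, e2]
    exact mul_le_mul_of_nonneg_right hhG (by positivity)
  -- (4) the P-term
  have h4 : 768 * Kc * P * G ≤ K * ((G + 1) ^ 2 * G ^ 2) := by
    have hPG : P ≤ G := by
      rw [hGdef]
      have h14 : (1 : ℝ) ≤ 4 * Real.pi ^ 2 := by nlinarith [Real.pi_gt_three]
      have := mul_le_mul_of_nonneg_right h14 hP0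
      linarith
    have hT : 64 * (G + 1) / (Real.pi ^ 4 * ν ^ 2) + 1 ≤ (64 / (Real.pi ^ 4 * ν ^ 2) + 1) * (G + 1) := by
      rw [add_mul, div_mul_eq_mul_div, one_mul]
      linarith
    have hT0 : 0 ≤ 64 * (G + 1) / (Real.pi ^ 4 * ν ^ 2) + 1 := by positivity
    have hK2 : Kc ≤ 4 * ((64 / (Real.pi ^ 4 * ν ^ 2) + 1) * (G + 1)) ^ 2 :=
      hK.trans (by gcongr)
    have s1 : 768 * Kc * P * G ≤ 768 * Kc * G * G := by
      have := mul_le_mul_of_nonneg_left hPG (by positivity : (0 : ℝ) ≤ 768 * Kc * G)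
      linarith
    have s2 : 768 * Kc * G * G ≤ 768 * (4 * ((64 / (Real.pi ^ 4 * ν ^ 2) + 1) * (G + 1)) ^ 2) * G * G := by
      have hGG : 0 ≤ G * G := by positivity
      have := mul_le_mul_of_nonneg_right hK2 hGG
      linarith
    have s3 : 768 * (4 * ((64 / (Real.pi ^ 4 * ν ^ 2) + 1) * (G + 1)) ^ 2) * G * G = K * ((G + 1) ^ 2 * G ^ 2) := by
      rw [hKdef]; ring
    linarith
  -- (5) combine
  have h5 : Ifz - Icz ≤ F / ν + K * ((G + 1) ^ 2 * G ^ 2) / ν + 3 * ν / 4 * D2 := by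
    have hCv : Cv ≤ K * ((G + 1) ^ 2 * G ^ 2) + ν ^ 2 / 4 * D2 := by nlinarith
    have hCv' : Cv / ν ≤ K * ((G + 1) ^ 2 * G ^ 2) / ν + ν / 4 * D2 := by
      have e : K * ((G + 1) ^ 2 * G ^ 2) / ν + ν / 4 * D2 = (K * ((G + 1) ^ 2 * G ^ 2) + ν ^ 2 / 4 * D2) / ν := by
        field_simp
      rw [e]
      exact div_le_div_of_nonneg_right hCv hν.le
    linarith
  -- (6) the weight
  have hK0 : 0 ≤ K := by rw [hKdef]; positivity
  have h6 : w * ((G + 1) ^ 2 * G ^ 2) ≤ 1 := by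
    rw [hwdef, inv_mul_le_iff₀ (by positivity), mul_one]
    have : G ^ 2 ≤ (1 + G) ^ 2 := by nlinarith
    calc (G + 1) ^ 2 * G ^ 2 ≤ (G + 1) ^ 2 * (1 + G) ^ 2 := mul_le_mul_of_nonneg_left this (by positivity)
      _ = (1 + G) ^ 4 := by ring
  have hw1 : w ≤ 1 := by
    rw [hwdef]
    exact inv_le_one_of_one_le₀ (one_le_pow₀ (by linarith))
  calc w * (Ifz - Icz) ≤ w * (F / ν + K * ((G + 1) ^ 2 * G ^ 2) / ν + 3 * ν / 4 * D2) :=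
        mul_le_mul_of_nonneg_left h5 hw0.le
    _ = w * (F / ν) + K / ν * (w * ((G + 1) ^ 2 * G ^ 2)) + 3 * ν / 4 * (w * D2) := by ring
    _ ≤ 1 * (F / ν) + K / ν * 1 + 3 * ν / 4 * (w * D2) := by
        gcongr
    _ = F / ν + K / ν + 3 * ν / 4 * (w * D2) := by ring

/-- **POINTWISE ABSORPTION (FGT, exponent 4).** For every level-`N` state `u`, `ν > 0`, smooth `f`:
`(1+G)⁻⁴ (∫⟪f,z⟫ − ∫⟪(ū·∇)ū,z⟫) ≤ ‖f‖₂²/ν + K(ν)/ν + (3ν/4)(1+G)⁻⁴∫‖z‖²`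
— the weighted Young inequality twice, the convection bound with the dyadic Agmon inequality at the ADAPTED cut
(which absorbs the `∫‖z‖²`-term pointwise), and `(1+G)⁻⁴ G²(G+1)² ≤ 1`. No smallness, no steadiness. [folklore] -/
theorem fgt_pointwise (hν : 0 < ν) (hf : Torus.IsSmooth f) (N : ℕ) (u : Torus.energySpace (Fin 3)) :
    fgtWeight N u * ((∫ x, ⟪f x, lapTrunc N u x⟫_ℝ) -
        ∫ x, ⟪Torus.convect (trunc N u) (trunc N u) x, lapTrunc N u x⟫_ℝ) ≤
      (∫ x, ‖f x‖ ^ 2) / ν + fgtConst ν / ν + 3 * ν / 4 * (fgtWeight N u * lapSq N u) := by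
  have hS := Torus.isSmooth_fourierTruncate N ((u.1 : L2T3) : UnitAddTorus (Fin 3) → EuclideanSpace ℝ (Fin 3))
  change Torus.IsSmooth (trunc N u) at hS
  have hZ : Torus.IsSmooth (lapTrunc N u) := Torus.isSmooth_realTrigPoly _ _
  have hP0 : 0 ≤ ∑ k ∈ Torus.freqBall N, Torus.freqNormSq k * ‖coef u k‖ ^ 2 :=
    Finset.sum_nonneg fun k _ => mul_nonneg (Torus.freqNormSq_nonneg _) (sq_nonneg _)
  have hQ0 : 0 ≤ ∑ k ∈ Torus.freqBall N, Torus.freqNormSq k ^ 2 * ‖coef u k‖ ^ 2 :=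
    Finset.sum_nonneg fun k _ => mul_nonneg (sq_nonneg _) (sq_nonneg _)
  have hG0 : 0 ≤ gradSq N u := gradSq_nonneg N u
  obtain ⟨i₀, hcut, hK⟩ := exists_adapted_cut hν (gradSq N u) hG0
  -- Young twice
  have ha : 0 < 2 / ν := by positivity
  have hY1 := (le_abs_self _).trans (abs_integral_inner_le_weighted (hf.memLp 2) (hZ.memLp 2) ha)
  have hY2 := (neg_le_abs _).trans
    (abs_integral_inner_le_weighted ((hS.convect hS).memLp 2) (hZ.memLp 2) ha)
  have hinv : (2 / ν)⁻¹ = ν / 2 := by rw [inv_div]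
  rw [hinv, ← lapSq_eq] at hY1 hY2
  -- convection with Agmon at the adapted cut
  have hAx : ∀ x, ‖trunc N u x‖ ≤ _ := fun x => norm_trunc_le (u := u) i₀ x
  have hconv := integral_norm_sq_convect_self_le hS hAx
  rw [integral_sum_norm_sq_partialDeriv_trunc u] at hconv
  have hA2 : (Real.sqrt (384 * (4 : ℝ) ^ i₀) * Real.sqrt (∑ k ∈ Torus.freqBall N, Torus.freqNormSq k * ‖coef u k‖ ^ 2) +
      Real.sqrt (128 * ((2 : ℝ)⁻¹) ^ i₀) *
        Real.sqrt (∑ k ∈ Torus.freqBall N, Torus.freqNormSq k ^ 2 * ‖coef u k‖ ^ 2)) ^ 2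
      ≤ 768 * (4 : ℝ) ^ i₀ * (∑ k ∈ Torus.freqBall N, Torus.freqNormSq k * ‖coef u k‖ ^ 2) +
        256 * ((2 : ℝ)⁻¹) ^ i₀ * (∑ k ∈ Torus.freqBall N, Torus.freqNormSq k ^ 2 * ‖coef u k‖ ^ 2) := by
    have e : ∀ a b : ℝ, (a + b) ^ 2 ≤ 2 * a ^ 2 + 2 * b ^ 2 := fun a b => by nlinarith [sq_nonneg (a - b)]
    refine (e _ _).trans ?_
    rw [mul_pow, mul_pow, Real.sq_sqrt (by positivity), Real.sq_sqrt hP0, Real.sq_sqrt (by positivity),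
      Real.sq_sqrt hQ0]
    linarith
  have h2 := hconv.trans (mul_le_mul_of_nonneg_right hA2 (by positivity))
  exact fgt_algebra hν (integral_nonneg fun x => by positivity) hP0 hQ0 hG0 rfl rfl (fgtWeight_pos N u) rfl
    (by positivity) hcut hK rfl hY1 hY2 (by positivity) h2

/-! ### Integration: the weighted `H²` bound from one stationarity identity -/

/-- `Σ_{ball} |k|⁴‖û k‖² ≤ N⁴ ‖u‖²` — the level-`N` Laplacian is bounded on bounded sets of `H`. [folklore] -/
theorem lapSq_le (N : ℕ) (u : Torus.energySpace (Fin 3)) : lapSq N u ≤ 16 * Real.pi ^ 4 * (N : ℝ) ^ 4 * ‖u‖ ^ 2 := by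
  unfold lapSq
  have hint := integrable_coe u
  have h1 : ∑ k ∈ Torus.freqBall N, Torus.freqNormSq k ^ 2 * ‖coef u k‖ ^ 2 ≤
      (N : ℝ) ^ 4 * ∑ k ∈ Torus.freqBall N, ‖coef u k‖ ^ 2 := by
    rw [Finset.mul_sum]
    refine Finset.sum_le_sum fun k hk => ?_
    have hq : Torus.freqNormSq k ≤ (N : ℝ) ^ 2 := Torus.mem_freqBall.1 hk
    have hq0 := Torus.freqNormSq_nonneg k
    have : Torus.freqNormSq k ^ 2 ≤ ((N : ℝ) ^ 2) ^ 2 := pow_le_pow_left₀ hq0 hq 2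
    rw [← pow_mul] at this
    exact mul_le_mul_of_nonneg_right this (sq_nonneg _)
  have h2 : ∑ k ∈ Torus.freqBall N, ‖coef u k‖ ^ 2 ≤ ‖u‖ ^ 2 := by
    have e := Torus.integral_norm_sq_fourierTruncate hint N
    have le := Torus.integral_norm_sq_fourierTruncate_le (Lp.memLp (u.1 : L2T3)) N
    rw [e] at le
    have : ‖u‖ = ‖(u.1 : L2T3)‖ := rfl
    rw [this, ← Torus.integral_norm_sq_coe_eq]
    exact le
  have hpi : 0 < Real.pi := Real.pi_pos
  nlinarith [mul_le_mul_of_nonneg_left (h1.trans (mul_le_mul_of_nonneg_left h2 (by positivity)))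
    (by positivity : (0 : ℝ) ≤ 16 * Real.pi ^ 4)]

/-- The per-mode coefficient maps are continuous on `H`. [folklore] -/
theorem continuous_coef (k : Fin 3 → ℤ) : Continuous fun u : Torus.energySpace (Fin 3) => coef u k :=
  (Torus.continuous_mFourierCoeff_complexify_coe k).comp continuous_subtype_val

/-- `continuous_lapSq` (bookkeeping). [folklore] -/
theorem continuous_lapSq (N : ℕ) : Continuous fun u : Torus.energySpace (Fin 3) => lapSq N u := by
  unfold lapSq
  exact continuous_const.mul (continuous_finsetSum _ fun k _ => continuous_const.mul ((continuous_coef k).norm.pow 2))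

/-- `continuous_gradSq` (bookkeeping). [folklore] -/
theorem continuous_gradSq (N : ℕ) : Continuous fun u : Torus.energySpace (Fin 3) => gradSq N u := by
  unfold gradSq
  exact continuous_const.mul (continuous_finsetSum _ fun k _ => continuous_const.mul ((continuous_coef k).norm.pow 2))

/-- `continuous_fgtWeight` (bookkeeping). [folklore] -/
theorem continuous_fgtWeight (N : ℕ) : Continuous fun u : Torus.energySpace (Fin 3) => fgtWeight N u := by
  unfold fgtWeight
  refine Continuous.inv₀ ((continuous_const.add (continuous_gradSq N)).pow 4) fun u => ?_
  have := gradSq_nonneg N u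
  positivity

/-- The weighted Laplacian `(1+G)⁻⁴ ∫‖ΔP_N u‖²` is integrable against any finite law with bounded support. [folklore] -/
theorem integrable_fgtWeight_mul_lapSq {μ : Measure (Torus.energySpace (Fin 3))} [IsFiniteMeasure μ] {R : ℝ}
    (hR : ∀ᵐ u ∂μ, ‖u‖ ≤ R) (N : ℕ) :
    Integrable (fun u => fgtWeight N u * lapSq N u) μ := by
  refine Integrable.mono' (integrable_const (16 * Real.pi ^ 4 * (N : ℝ) ^ 4 * R ^ 2))
    ((continuous_fgtWeight N).mul (continuous_lapSq N)).aestronglyMeasurable (hR.mono fun u hu => ?_)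
  have hw0 := (fgtWeight_pos N u).le
  have hw1 := fgtWeight_le_one N u
  have hl0 := lapSq_nonneg N u
  rw [Real.norm_eq_abs, abs_of_nonneg (mul_nonneg hw0 hl0)]
  have hR2 : ‖u‖ ^ 2 ≤ R ^ 2 := by
    have := norm_nonneg u
    nlinarith
  have hpi : 0 < Real.pi := Real.pi_pos
  calc fgtWeight N u * lapSq N u ≤ 1 * lapSq N u := mul_le_mul_of_nonneg_right hw1 hl0
    _ ≤ 16 * Real.pi ^ 4 * (N : ℝ) ^ 4 * ‖u‖ ^ 2 := by rw [one_mul]; exact lapSq_le N u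
    _ ≤ 16 * Real.pi ^ 4 * (N : ℝ) ^ 4 * R ^ 2 := by gcongr

/-- **FOIAS–GUILLOPÉ–TEMAM BOUND FROM ONE STATIONARITY IDENTITY (exponent 4).** If a probability law on `H`,
carried by level-`N` fields and supported in a ball, annihilates the single weighted row
`u ↦ (1+G(u))⁻⁴ ⟨F(u), −ΔP_N u⟩` (the generator row of the cylindrical functional `−(1+G)⁻³/3·(1/2)`, admissible
for Galerkin-INVARIANT laws), then `∫ (1+G)⁻⁴ ∫‖ΔP_N u‖² dμ ≤ 4(‖f‖₂² + K(ν))/ν²` — N-UNIFORM, and even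
independent of the support radius. [folklore] -/
theorem fgt_integral_bound (hν : 0 < ν) (hf : Torus.IsSmooth f) (N : ℕ)
    {μ : Measure (Torus.energySpace (Fin 3))} [IsProbabilityMeasure μ] {R : ℝ} (hR : ∀ᵐ u ∂μ, ‖u‖ ≤ R)
    (hlev : ∀ᵐ u ∂μ, IsLevel N u)
    (hint : Integrable (fun u => fgtWeight N u * Torus.nsGeneratorPairing ν f u (lapTrunc N u)) μ)
    (hstat : ∫ u, fgtWeight N u * Torus.nsGeneratorPairing ν f u (lapTrunc N u) ∂μ = 0) :
    ∫ u, fgtWeight N u * lapSq N u ∂μ ≤ 4 * ((∫ x, ‖f x‖ ^ 2) + fgtConst ν) / ν ^ 2 := by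
  set F : ℝ := ∫ x, ‖f x‖ ^ 2 with hF
  -- the a.e. pointwise inequality (ν/4) w D2 ≤ F/ν + K/ν − w ⟨F(u), z⟩
  have hae : ∀ᵐ u ∂μ, ν / 4 * (fgtWeight N u * lapSq N u) ≤
      (F / ν + fgtConst ν / ν) - fgtWeight N u * Torus.nsGeneratorPairing ν f u (lapTrunc N u) := by
    filter_upwards [hlev] with u hu
    have hp := fgt_pointwise hν hf N u
    rw [nsGeneratorPairing_lapTrunc_eq ν hf hu, ← lapSq_eq]
    have e : fgtWeight N u * ((∫ x, ⟪f x, lapTrunc N u x⟫_ℝ) -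
        (∫ x, ⟪Torus.convect (trunc N u) (trunc N u) x, lapTrunc N u x⟫_ℝ) - ν * lapSq N u) =
        fgtWeight N u * ((∫ x, ⟪f x, lapTrunc N u x⟫_ℝ) -
          ∫ x, ⟪Torus.convect (trunc N u) (trunc N u) x, lapTrunc N u x⟫_ℝ) - ν * (fgtWeight N u * lapSq N u) := by
      ring
    rw [e]
    linarith
  have hI1 : Integrable (fun u => ν / 4 * (fgtWeight N u * lapSq N u)) μ :=
    (integrable_fgtWeight_mul_lapSq hR N).const_mul _
  have hI2 : Integrable (fun u => (F / ν + fgtConst ν / ν) -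
      fgtWeight N u * Torus.nsGeneratorPairing ν f u (lapTrunc N u)) μ :=
    (integrable_const _).sub hint
  have hmono := integral_mono_ae hI1 hI2 hae
  rw [integral_const_mul, integral_sub (integrable_const _) hint, hstat, sub_zero, integral_const,
    probReal_univ, one_smul] at hmono
  rw [le_div_iff₀ (by positivity)]
  have : ν * (ν / 4 * ∫ u, fgtWeight N u * lapSq N u ∂μ) ≤ ν * (F / ν + fgtConst ν / ν) :=
    mul_le_mul_of_nonneg_left hmono hν.le
  have e : ν * (F / ν + fgtConst ν / ν) = F + fgtConst ν := by field_simp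
  rw [e] at this
  nlinarith

/-! ### The `ℝ≥0∞` form: `WeightedH2Bound 4` for FGT-stationary level-`N` laws -/

/-- For a level-`N` field, the spectral enstrophy of the representative is `G(u)`. [folklore] -/
theorem eGradNormSq_coe_eq_ofReal_gradSq (hu : IsLevel N u) :
    Torus.eGradNormSq ((u.1 : L2T3) : UnitAddTorus (Fin 3) → EuclideanSpace ℝ (Fin 3)) = ENNReal.ofReal (gradSq N u) := by
  rw [← CubicParityLoud.Negative.eGradNormSq_fourierTruncate_of_isLevel (N := N) (u := u) hu]
  change Torus.eGradNormSq (trunc N u) = _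
  rw [trunc_eq, Torus.eGradNormSq_realTrigPoly Torus.neg_mem_freqBall_of_mem (isConjSymm_coef u)]
  rfl

/-- The weighted `H²` density of a level-`N` field in real terms. [folklore] -/
theorem weightedDensity_eq_ofReal (hu : IsLevel N u) :
    eLapNormSq ((u.1 : L2T3) : UnitAddTorus (Fin 3) → EuclideanSpace ℝ (Fin 3)) /
        (1 + Torus.eGradNormSq ((u.1 : L2T3) : UnitAddTorus (Fin 3) → EuclideanSpace ℝ (Fin 3))) ^ 4 =
      ENNReal.ofReal (fgtWeight N u * lapSq N u) := by
  rw [eLapNormSq_coe_of_isLevel u hu, ← lapSq_eq, eGradNormSq_coe_eq_ofReal_gradSq hu]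
  have hG := gradSq_nonneg N u
  have hpos : 0 < (1 + gradSq N u) ^ 4 := by positivity
  rw [← ENNReal.ofReal_one, ← ENNReal.ofReal_add zero_le_one hG, ← ENNReal.ofReal_pow (by linarith),
    ← ENNReal.ofReal_div_of_pos hpos, fgtWeight, inv_mul_eq_div]

/-- **`ℝ≥0∞` FGT bound for one law.** [folklore] -/
theorem lintegral_weightedDensity_le_of_fgt (hν : 0 < ν) (hf : Torus.IsSmooth f) (N : ℕ)
    {μ : Measure (Torus.energySpace (Fin 3))} [IsProbabilityMeasure μ] {R : ℝ} (hR : ∀ᵐ u ∂μ, ‖u‖ ≤ R)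
    (hlev : ∀ᵐ u ∂μ, IsLevel N u)
    (hint : Integrable (fun u => fgtWeight N u * Torus.nsGeneratorPairing ν f u (lapTrunc N u)) μ)
    (hstat : ∫ u, fgtWeight N u * Torus.nsGeneratorPairing ν f u (lapTrunc N u) ∂μ = 0) :
    ∫⁻ u, eLapNormSq ((u.1 : L2T3) : UnitAddTorus (Fin 3) → EuclideanSpace ℝ (Fin 3)) /
        (1 + Torus.eGradNormSq ((u.1 : L2T3) : UnitAddTorus (Fin 3) → EuclideanSpace ℝ (Fin 3))) ^ 4 ∂μ ≤
      ENNReal.ofReal (4 * ((∫ x, ‖f x‖ ^ 2) + fgtConst ν) / ν ^ 2) := by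
  rw [lintegral_congr_ae (hlev.mono fun u hu => weightedDensity_eq_ofReal hu),
    ← ofReal_integral_eq_lintegral_ofReal (integrable_fgtWeight_mul_lapSq hR N)
      (ae_of_all _ fun u => mul_nonneg (fgtWeight_pos N u).le (lapSq_nonneg N u))]
  exact ENNReal.ofReal_le_ofReal (fgt_integral_bound hν hf N hR hlev hint hstat)

/-- A law is **FGT-stationary at level `N`** for `(ν, f)`: it is a probability law carried by level-`N` fields,
supported in some ball, and annihilates the single weighted row `(1+G)⁻⁴⟨F(u), −ΔP_N u⟩` (integrable row).
Galerkin-INVARIANT laws with bounded support are FGT-stationary (the row is the generator of the `C¹`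
cylindrical functional `−(1+G)⁻³/6`). -/
def IsFGTStationary (ν : ℝ) (f : UnitAddTorus (Fin 3) → EuclideanSpace ℝ (Fin 3)) (N : ℕ)
    (μ : Measure (Torus.energySpace (Fin 3))) : Prop :=
  IsProbabilityMeasure μ ∧ (∃ R : ℝ, ∀ᵐ u ∂μ, ‖u‖ ≤ R) ∧ (∀ᵐ u ∂μ, IsLevel N u) ∧
    Integrable (fun u => fgtWeight N u * Torus.nsGeneratorPairing ν f u (lapTrunc N u)) μ ∧
    ∫ u, fgtWeight N u * Torus.nsGeneratorPairing ν f u (lapTrunc N u) ∂μ = 0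

/-- **`WeightedH2Bound 4` for every family of FGT-stationary laws** (levels and radii may vary over the family;
the constant `4(‖f‖₂² + K(ν))/ν²` does not see them). [folklore] -/
theorem weightedH2Bound_four_of_fgt (hν : 0 < ν) (hf : Torus.IsSmooth f)
    {𝓕 : Set (Measure (Torus.energySpace (Fin 3)))} (h𝓕 : ∀ μ ∈ 𝓕, ∃ N, IsFGTStationary ν f N μ) :
    WeightedH2Bound 4 𝓕 := by
  refine ⟨ENNReal.ofReal (4 * ((∫ x, ‖f x‖ ^ 2) + fgtConst ν) / ν ^ 2), ENNReal.ofReal_ne_top, fun μ hμ => ?_⟩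
  obtain ⟨N, hprob, ⟨R, hR⟩, hlev, hint, hstat⟩ := h𝓕 μ hμ
  haveI := hprob
  exact lintegral_weightedDensity_le_of_fgt hν hf N hR hlev hint hstat

end FGT

end

end Summit.AnomalousDissipation.AnomalousDissipation.Theorems.UniformResolution.Negative
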